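import Summits.QuantumFields.QCD.Theses.HeatSlicedQuarks

/-!
# `RobustYangMillsHandover` — tightness: the free Wilson–Dirac operator's constant modes sit at
# the bare mass (negative lane, cycle 2; definition-free)

Companion of `Negative/SchemeAsymptotics.lean` (ii)/(ii′) and of the route's support item
`AccretiveWilsonDirac` (stmt-QuantumFields-8875, `Re⟨v, D_W v⟩ = m‖v‖² + ½Σ‖U v(x+μ̂) − v(x)‖²`).
For the TRIVIAL gauge field `U ≡ 1` and any site-constant colour–spin vector `v(x, a, α) = w(a, α)`
the tree's `wilsonDirac ρ 1 m r` acts as multiplication by the bare mass: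
`D_W v = m v` (`wilsonDirac_one_mulVec_const`; the forward hops contribute `(r − γ_μ)w`, the backward
hops `(r + γ_μ)w`, the Wilson terms `4r` cancel against the diagonal `m + 4r`, the `γ`'s cancel
pairwise).  Hence the accretivity bound is ATTAINED (`accretivity_tight`:
`Re⟨v, D_W(1, m, r) v⟩ = m‖v‖²`) and at a NEGATIVE bare mass the numerical range of the fine-lattice
operator contains negative values (`numericalRange_neg_of_mass_neg`).  Read with
`scheme_mq_eventually_neg(_of_logBound)`: along the handed-over bare trajectory of crux
`stmt-QuantumFields-8892` the fine Wilson–Dirac operator is eventually NOT coercive at smooth fields, so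
the informal mechanism's "coercivity of the tuned flow" can only concern a blocked operator below the
quark scale.  (cdisprove seat refuter-cdisprove-stmt-QuantumFields-8892-g2-0, 2026-08-16.)
-/

namespace Summit.QuantumFields.QCD.Theorems.RobustYangMillsHandover.Negative

open Literature.MathematicalPhysics.QuantumLattice Literature.MathematicalPhysics.QuantumFieldTheory
open Literature.Probability.LatticeModels Matrix Finset

variable {L N : ℕ} {G : Type*} [Group G] (ρ : G →* Matrix (Fin N) (Fin N) ℂ)

/-- `p = q + e_μ ↔ q = p − e_μ` on the discrete torus. [folklore] -/
theorem eq_site_shift_iff (p q : TorusSite 4 L) (μ : Fin 4) :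
    p = Literature.MathematicalPhysics.QuantumFieldTheory.Site.shift q μ ↔ q = p - Pi.single μ 1 := by
  simp only [Literature.MathematicalPhysics.QuantumFieldTheory.Site.shift]
  constructor
  · rintro rfl; simp
  · rintro rfl; simp

/-- At fixed spin row, forward `(r − γ_μ)` plus backward `(r + γ_μ)` contracted with a colour–spin
vector give `2r` times the vector. [folklore] -/
theorem hopPair_sum (r : ℝ) (μ : Fin 4) (w : Fin N × Fin 4 → ℂ) (p : TorusSite 4 L × Fin N × Fin 4) :
    ∑ β : Fin 4, ((r : ℂ) • (1 : Matrix (Fin 4) (Fin 4) ℂ) - euclideanGamma μ) p.2.2 β * w (p.2.1, β) +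
      ∑ β : Fin 4, ((r : ℂ) • (1 : Matrix (Fin 4) (Fin 4) ℂ) + euclideanGamma μ) p.2.2 β * w (p.2.1, β) =
      2 * (r : ℂ) * w p.2 := by
  rw [← Finset.sum_add_distrib]
  have : ∀ β : Fin 4, ((r : ℂ) • (1 : Matrix (Fin 4) (Fin 4) ℂ) - euclideanGamma μ) p.2.2 β * w (p.2.1, β) +
      ((r : ℂ) • (1 : Matrix (Fin 4) (Fin 4) ℂ) + euclideanGamma μ) p.2.2 β * w (p.2.1, β) =
      if p.2.2 = β then 2 * (r : ℂ) * w (p.2.1, β) else 0 := by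
    intro β
    simp only [Matrix.sub_apply, Matrix.add_apply, Matrix.smul_apply, Matrix.one_apply, smul_eq_mul]
    split_ifs <;> ring
  simp_rw [this]
  rw [Finset.sum_ite_eq]
  simp

variable [NeZero L]

/-- The forward hopping term of `wilsonDirac ρ 1 m r` on a site-constant vector collapses to the
spin matrix `(r − γ_μ)`. [folklore] -/
theorem wilsonHopFwd_one_sum (r : ℝ) (μ : Fin 4) (w : Fin N × Fin 4 → ℂ) (p : TorusSite 4 L × Fin N × Fin 4) :
    ∑ x : TorusSite 4 L × Fin N × Fin 4,
      (if x.1 = Literature.MathematicalPhysics.QuantumFieldTheory.Site.shift p.1 μ then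
        ((r : ℂ) • (1 : Matrix (Fin 4) (Fin 4) ℂ) - euclideanGamma μ) p.2.2 x.2.2 *
          (1 : Matrix (Fin N) (Fin N) ℂ) p.2.1 x.2.1 else 0) * w x.2 =
      ∑ β : Fin 4, ((r : ℂ) • (1 : Matrix (Fin 4) (Fin 4) ℂ) - euclideanGamma μ) p.2.2 β * w (p.2.1, β) := by
  rw [Fintype.sum_prod_type,
    Finset.sum_eq_single (Literature.MathematicalPhysics.QuantumFieldTheory.Site.shift p.1 μ)]
  · simp only [if_true]
    rw [Fintype.sum_prod_type, Finset.sum_eq_single p.2.1]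
    · simp [Matrix.one_apply]
    · intro b _ hb
      simp [Matrix.one_apply, Ne.symm hb]
    · simp
  · intro q1 _ hq1
    simp [hq1]
  · simp

/-- The backward hopping term of `wilsonDirac ρ 1 m r` on a site-constant vector collapses to the
spin matrix `(r + γ_μ)`. [folklore] -/
theorem wilsonHopBwd_one_sum (r : ℝ) (μ : Fin 4) (w : Fin N × Fin 4 → ℂ) (p : TorusSite 4 L × Fin N × Fin 4) :
    ∑ x : TorusSite 4 L × Fin N × Fin 4,
      (if p.1 = Literature.MathematicalPhysics.QuantumFieldTheory.Site.shift x.1 μ then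
        ((r : ℂ) • (1 : Matrix (Fin 4) (Fin 4) ℂ) + euclideanGamma μ) p.2.2 x.2.2 *
          (1 : Matrix (Fin N) (Fin N) ℂ) p.2.1 x.2.1 else 0) * w x.2 =
      ∑ β : Fin 4, ((r : ℂ) • (1 : Matrix (Fin 4) (Fin 4) ℂ) + euclideanGamma μ) p.2.2 β * w (p.2.1, β) := by
  simp_rw [eq_site_shift_iff]
  rw [Fintype.sum_prod_type, Finset.sum_eq_single (p.1 - Pi.single μ 1)]
  · simp only [if_true]
    rw [Fintype.sum_prod_type, Finset.sum_eq_single p.2.1]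
    · simp [Matrix.one_apply]
    · intro b _ hb
      simp [Matrix.one_apply, Ne.symm hb]
    · simp
  · intro q1 _ hq1
    simp [hq1]
  · simp

/-- **The free Wilson–Dirac operator's constant modes sit at the bare mass.** For the trivial gauge
field and every site-constant colour–spin vector `v(x, a, α) = w(a, α)`:
`(D_W(1, m, r) v)(x, a, α) = m · w(a, α)` — the `4r` of the diagonal cancels against the eight hops,
the `γ_μ` cancel between forward and backward hops. (The `p = 0` corner of the free symbol
`m + r Σ(1 − cos p_μ) + i Σ γ_μ sin p_μ`.) [folklore] -/
theorem wilsonDirac_one_mulVec_const (m r : ℝ) (w : Fin N × Fin 4 → ℂ) (p : TorusSite 4 L × Fin N × Fin 4) :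
    ((wilsonDirac ρ (1 : GaugeConfig 4 L G) m r) *ᵥ (fun q => w q.2)) p = (m : ℂ) * w p.2 := by
  simp only [Matrix.mulVec, dotProduct, wilsonDirac, Matrix.of_apply, Pi.one_apply, map_one, inv_one]
  simp_rw [sub_mul, Finset.sum_sub_distrib]
  have hdiag : ∑ x : TorusSite 4 L × Fin N × Fin 4, (if p = x then ((m + 4 * r : ℝ) : ℂ) else 0) * w x.2 =
      ((m + 4 * r : ℝ) : ℂ) * w p.2 := by
    simp_rw [ite_mul, zero_mul]
    rw [Finset.sum_ite_eq]
    simp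
  rw [hdiag]
  set F : TorusSite 4 L × Fin N × Fin 4 → Fin 4 → ℂ := fun x μ =>
    if x.1 = Literature.MathematicalPhysics.QuantumFieldTheory.Site.shift p.1 μ then
      ((r : ℂ) • (1 : Matrix (Fin 4) (Fin 4) ℂ) - euclideanGamma μ) p.2.2 x.2.2 *
        (1 : Matrix (Fin N) (Fin N) ℂ) p.2.1 x.2.1 else 0 with hF
  set B : TorusSite 4 L × Fin N × Fin 4 → Fin 4 → ℂ := fun x μ =>
    if p.1 = Literature.MathematicalPhysics.QuantumFieldTheory.Site.shift x.1 μ then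
      ((r : ℂ) • (1 : Matrix (Fin 4) (Fin 4) ℂ) + euclideanGamma μ) p.2.2 x.2.2 *
        (1 : Matrix (Fin N) (Fin N) ℂ) p.2.1 x.2.1 else 0 with hB
  have hstep : ∀ μ : Fin 4, ∑ x : TorusSite 4 L × Fin N × Fin 4, (F x μ + B x μ) * w x.2 =
      2 * (r : ℂ) * w p.2 := by
    intro μ
    simp_rw [add_mul, Finset.sum_add_distrib]
    rw [hF, hB]
    simp only
    rw [wilsonHopFwd_one_sum, wilsonHopBwd_one_sum, hopPair_sum]
  have hhop : ∑ x : TorusSite 4 L × Fin N × Fin 4, (1 / 2 : ℂ) * (∑ μ : Fin 4, (F x μ + B x μ)) * w x.2 =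
      (4 * r : ℂ) * w p.2 := by
    calc ∑ x : TorusSite 4 L × Fin N × Fin 4, (1 / 2 : ℂ) * (∑ μ : Fin 4, (F x μ + B x μ)) * w x.2
        = (1 / 2 : ℂ) * ∑ x : TorusSite 4 L × Fin N × Fin 4, ∑ μ : Fin 4, (F x μ + B x μ) * w x.2 := by
          rw [Finset.mul_sum]
          refine Finset.sum_congr rfl fun x _ => ?_
          rw [mul_assoc, Finset.sum_mul]
      _ = (1 / 2 : ℂ) * ∑ μ : Fin 4, ∑ x : TorusSite 4 L × Fin N × Fin 4, (F x μ + B x μ) * w x.2 := by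
          rw [Finset.sum_comm]
      _ = (1 / 2 : ℂ) * ∑ μ : Fin 4, 2 * (r : ℂ) * w p.2 := by
          simp_rw [hstep]
      _ = (4 * r : ℂ) * w p.2 := by
          simp only [Finset.sum_const, Finset.card_univ, Fintype.card_fin, nsmul_eq_mul]
          push_cast
          ring
  rw [hhop]
  push_cast
  ring

/-- Vector form: site-constant vectors are eigenvectors of `D_W(1, m, r)` with eigenvalue `m`.
[folklore] -/
theorem wilsonDirac_one_mulVec_const_eq_smul (m r : ℝ) (w : Fin N × Fin 4 → ℂ) :
    (wilsonDirac ρ (1 : GaugeConfig 4 L G) m r) *ᵥ (fun q => w q.2) = (m : ℂ) • fun q => w q.2 := by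
  ext p
  rw [wilsonDirac_one_mulVec_const]
  rfl

/-- **Tightness of the accretivity bound.** At `U ≡ 1`, on site-constant vectors, the quadratic
form of the Wilson–Dirac operator is EXACTLY `m‖v‖²` (the Wilson term `½Σ‖U v(x+μ̂) − v(x)‖²` of
`AccretiveWilsonDirac` vanishes): the bound `Re⟨v, D_W v⟩ ≥ m‖v‖²` cannot be improved uniformly in
`U`. [folklore] -/
theorem accretivity_tight (m r : ℝ) (w : Fin N × Fin 4 → ℂ) :
    (∑ i, star ((fun q : TorusSite 4 L × Fin N × Fin 4 => w q.2) i) *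
        ((wilsonDirac ρ (fun _ => 1 : GaugeConfig 4 L G) m r).mulVec (fun q => w q.2)) i).re =
      m * ∑ i : TorusSite 4 L × Fin N × Fin 4, ‖w i.2‖ ^ 2 := by
  have h1 : (fun _ => 1 : GaugeConfig 4 L G) = 1 := rfl
  rw [h1]
  simp_rw [wilsonDirac_one_mulVec_const]
  have : ∀ i : TorusSite 4 L × Fin N × Fin 4,
      star (w i.2) * ((m : ℂ) * w i.2) = ((m * ‖w i.2‖ ^ 2 : ℝ) : ℂ) := by
    intro i
    rw [mul_left_comm, Complex.star_def, Complex.conj_mul']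
    push_cast
    ring
  simp_rw [this]
  rw [← Complex.ofReal_sum, Complex.ofReal_re, Finset.mul_sum]

/-- **Negative numerical range at negative bare mass.** For `m < 0` the fine-lattice Wilson–Dirac
operator at the trivial (smoothest possible) gauge field has `Re⟨v, D_W v⟩ < 0` on every non-zero
site-constant vector: no coercivity `Re⟨v, D_W v⟩ ≥ c‖v‖²`, `c > 0`, can hold at the bare masses
`m_f(k) < 0` of the handed-over trajectory (`scheme_mq_eventually_neg_of_logBound`). [folklore] -/
theorem numericalRange_neg_of_mass_neg (m r : ℝ) (hm : m < 0) (w : Fin N × Fin 4 → ℂ) (hw : w ≠ 0) :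
    (∑ i, star ((fun q : TorusSite 4 L × Fin N × Fin 4 => w q.2) i) *
        ((wilsonDirac ρ (fun _ => 1 : GaugeConfig 4 L G) m r).mulVec (fun q => w q.2)) i).re < 0 := by
  rw [accretivity_tight]
  refine mul_neg_of_neg_of_pos hm ?_
  obtain ⟨j, hj⟩ : ∃ j, w j ≠ 0 := by
    by_contra h
    push Not at h
    exact hw (funext h)
  have hle : ‖w j‖ ^ 2 ≤ ∑ i : TorusSite 4 L × Fin N × Fin 4, ‖w i.2‖ ^ 2 := by
    have := Finset.single_le_sum (f := fun i : TorusSite 4 L × Fin N × Fin 4 => ‖w i.2‖ ^ 2)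
      (fun i _ => by positivity) (Finset.mem_univ ((0 : TorusSite 4 L), j))
    simpa using this
  have hpos : 0 < ‖w j‖ ^ 2 := by positivity
  linarith

/-- The route's setting (`SU(3)`, fundamental representation, `r = 1`): the exact LHS of
`AccretiveWilsonDirac` evaluated at `U ≡ 1` on a site-constant vector equals `m‖v‖²`. [folklore] -/
theorem accretiveWilsonDirac_tight_su3 (m : ℝ) (w : Fin 3 × Fin 4 → ℂ) :
    (∑ i, star ((fun q : TorusSite 4 L × Fin 3 × Fin 4 => w q.2) i) *
        ((wilsonDirac (fundamentalRep (Fin 3))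
          (fun _ => 1 : GaugeConfig 4 L (Matrix.specialUnitaryGroup (Fin 3) ℂ)) m 1).mulVec
            (fun q => w q.2)) i).re =
      m * ∑ i : TorusSite 4 L × Fin 3 × Fin 4, ‖w i.2‖ ^ 2 :=
  accretivity_tight _ m 1 w

end Summit.QuantumFields.QCD.Theorems.RobustYangMillsHandover.Negative
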